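import Literature.MathematicalPhysics.QuantumFieldTheory.Balaban1983to89.Node00.Record8
import Summits.QuantumFields.YangMills.Theorems.BalabanUVNodesN28GammaCap

/-!
# BalabanUVNodes ∕ N28 — binder B6 «`0 < β̄`, `0 < γc`» AT A STAGE-8 RECORD `Node00.IsRecordOfRecord₈C`:
# the two witnesses at the datum of record, by name (Track A, DAG node N28 of 28; YM-PLAN §2d row B6; count-neutral)

HONEST FRAMING.  Count-neutral kernel bookkeeping at NODE 00's Stage-8 record predicate; NOT a node discharge, not an
estimate.  N28 is VACATED in the discharge form of record and «closes with B3» (N25 = NODE O).  This module instantiates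
the general provenance lemmas of `Summits/…/BalabanUVNodesN28AtBetaOfRecord.lean` (p412300; parameters `βm β⁰ γ`) and the γc-cap `iff`
of `Summits/…/BalabanUVNodesN28GammaCap.lean` at the β-FUNCTIONS OF RECORD of Stage 8, `Node00.betaOfRecord₈ θ = betaOfMerged βm₈ (beta0OfMerged βm₈ θ.v₀) θ.γ` with
`βm₈ := betaMerged F (mergedTermFamilyMat F N (chi7 F N θ) θ.εbg) θ.ρ8 θ.bV` (`Node00/Record8.lean`; the datum's `βfun` IS this
object, `Node00.βfun_stage8`, `rfl`).  Everything is elementary; `θ` is a PARAMETER — nothing of Bałaban's β is asserted, no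
satisfiability is claimed.  One finite four-torus programme at fixed `ε`; nothing continuum ∕ ℝ⁴ ∕ OS ∕ mass-gap ∕ Clay.
0 `def`, 0 `sorry`, standard axioms.

WHAT IS PROVED (where N28's two positivity witnesses live at D₀ = a Stage-8 record `(D, w)`).
* §1 THE `γc`-HALF.  The GUARD `0 < θ.γ` is a clause of Stage-8 admissibility (`gamma_pos_of_admissible₈`), so the
  constant-collapse `β ≡ β⁰` of a non-positive record box (`N28AtBetaOfRecord.betaOfMerged_of_nonpos`) never occurs at an
  admissible `θ`.  (Binder (B4) itself at the record — `BetaContH γc D.βfun ↔` joint continuity of the MERGED β `βm₈` on the box,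
  `γc ≤ θ.γ` — is dag-n26-a's `BalabanUVNodesN26AtRecord8.betaContH_datumOfRecord₈_iff`, not restated here; this file uses only the
  one-step restriction-and-transport `N28AtBetaOfRecord.betaContH_betaOfMerged_of_le`.)  At a record `(D, w)` the γ-clause of
  `IsRecordOfRecord₈C` is `0 < w.γ ∧ w.γ ≤ θ.γ`: (B4) with N28's side condition holds
  with the witness `γc := w.γ` — THE BINDING WORLD'S OWN SMALL-COUPLING WINDOW — as soon as `βm₈` is jointly continuous on the
  record box (`b4_with_sideCondition_record₈`, `exists_b4_of_isRecordOfRecord₈C`).  AND NEVER LARGER in general: by the cap `iff`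
  (`N28GammaCap.betaContH_betaOfMerged_iff_of_lt`), (B4) for the datum on a box `γc > θ.γ` holds IFF it holds for `βm₈` on the record
  box AND `βm₈` sits at its one-loop number `beta0OfMerged βm₈ θ.v₀ k` on the whole outer face `max_i g_i = θ.γ` — a constraint on
  Bałaban's β, never a free witness (`betaContH_record₈_iff_of_lt`, `merged₈_eq_beta0_on_outerFace_of_betaContH`).
* §2 THE `β̄`-HALF.  Every `Sβ : OneLoopSplit D.βfun` a NODE-O road carries IS the split of record: `Sβ = Node00.oneLoopSplit_stage8 θ`
  (`oneLoopSplit_record₈_eq`), so `Sβ.β0 k = beta0OfMerged βm₈ θ.v₀ k` BY NAME (`oneLoopSplit_β0_record₈`); the wall input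
  `RemainderConst Sβ γ' r` (`γ' ≤ θ.γ`) IS `|βm₈ − β⁰| ≤ r` on the boxes (`remainderConst_record₈_iff`); a uniform AF bound
  `0 < b ≤ D.βfun` on a box `]0,γ']^{k+1}`, `γ' ≤ θ.γ`, containing the admissible reference history `θ.v₀`, together with the NAMED
  `Beta0LimitExists βm₈ θ.v₀`, gives `0 < b ≤ β⁰_k` for every `k` — (AF-0) of the one-loop numbers OF RECORD
  (`beta0_record₈_pos_of_betaLowerH`); and the LITERAL (B3) at the record is rigid: `BetaPertH D.βfun β̄` + vanishing remainder ⇒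
  `β⁰_k = β̄ ∀ k` (`beta0_record₈_eq_betabar_of_literalB3`) — why N28 is VACATED with the literal (B3).
* §3 N28's LITERAL PAIR.  The packaged binder `T4Continuum.BetaPertHyp D.βfun` (= (B3) ∧ `0 < β̄` ∧ (B4) ∧ `0 < γc`) at an
  admissible Stage-8 `θ` is the same statement about `βm₈` (`betaPertHyp_record₈_iff`).
Sources: T. Bałaban, CMP **109** (1987) 249–301 [Balaban1987RG1] (1.22) p. 264, (2.12)–(2.14) p. 268, Thm 2 (0.31) p. 259;
CMP **122** (1989) 355–392 [Balaban1989LargeFieldII] Thm 1 p. 355.  Nothing here is a claim about the Yang–Mills mass gap.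
-/

namespace Summit.QuantumFields.YangMills.BalabanUVNodes.N28AtRecord8

open Literature.MathematicalPhysics.QuantumFieldTheory.Balaban1983to89
open Literature.MathematicalPhysics.QuantumFieldTheory.Balaban1983to89.FlowStep
open Literature.MathematicalPhysics.QuantumFieldTheory.Balaban1983to89.Node00
open Literature.MathematicalPhysics.QuantumFieldTheory.Balaban1983to89.T4Continuum (T4Family BetaPertHyp FiniteEpsData)
open Literature.MathematicalPhysics.QuantumFieldTheory.Balaban1983to89.DagBinding (WorldP)
open Literature.MathematicalPhysics.QuantumFieldTheory.Balaban1983to89.Beta.RemainderChain (RemainderConst)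
open Literature.MathematicalPhysics.QuantumFieldTheory.Balaban1983to89.BetaPertRigid (RemainderVanishes)
open Summit.QuantumFields.YangMills.BalabanUVNodes.N28AtBetaOfRecord
open Summit.QuantumFields.YangMills.BalabanUVNodes.N28GammaCap (merged_eq_beta0_on_outerFace_of_betaContH
  betaContH_betaOfMerged_iff_of_lt)
open Filter Topology
open scoped Matrix.Norms.L2Operator

/-! ## §1 The `γc`-half at a Stage-8 record -/

variable {F : T4Family} {N : ℕ} [NeZero N]

/-- **THE GUARD IS ADMISSIBILITY.**  At admissible Stage-8 parameters the record box side is positive, `0 < θ.γ` (a clause of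
`Node00.Stage5Params.Admissible`, inherited) — so the β of record is never the constant family of its one-loop numbers by an
empty box (`N28AtBetaOfRecord.betaOfMerged_of_nonpos` is excluded). [cite: Balaban1989LargeFieldII, Thm 1 p.355 («sufficiently small positive γ»)] -/
theorem gamma_pos_of_admissible₈ {θ : Stage8Params F N} (hθ : θ.Admissible) : 0 < θ.γ := hθ.1.1.2

/-- At a Stage-8 record the binding world's window is positive and inside the record box: `0 < w.γ ≤ θ.γ` for the witnessing
`θ`, whose β of record IS the datum's (the γ-clause (B′) of `IsRecordOfRecord₈C`, unfolded with `βfun_stage8`).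
[cite: Balaban1989LargeFieldII, Thm 1 p.355] -/
theorem exists_window_of_isRecordOfRecord₈C {D : FiniteEpsData F (SU N)} {w : WorldP} (h : IsRecordOfRecord₈C F N D w) :
    ∃ θ : Stage8Params F N, θ.Admissible ∧ D = datumOfRecord₅ F N (θ.toStage5 F N) ∧
      D.βfun = betaOfRecord₈ F N θ ∧ 0 < w.γ ∧ w.γ ≤ θ.γ ∧ 0 < θ.γ := by
  obtain ⟨θ, hθ, hD, -, ⟨hγ0, hγle⟩, -, -⟩ := h
  subst hD
  exact ⟨θ, hθ, rfl, βfun_stage8 F N θ, hγ0, hγle, gamma_pos_of_admissible₈ hθ⟩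

/-- N28's `0 < γc` at a Stage-8 record, read on the world: `0 < w.γ`. [cite: Balaban1989LargeFieldII, Thm 1 p.355] -/
theorem window_pos_of_isRecordOfRecord₈C {D : FiniteEpsData F (SU N)} {w : WorldP} (h : IsRecordOfRecord₈C F N D w) :
    0 < w.γ := by
  obtain ⟨_, _, _, _, ⟨hγ0, _⟩, _⟩ := h
  exact hγ0

/-- **WHERE N28's `γc` LIVES AT D₀.**  For Stage-8 parameters `θ` and a world `w` obeying the record's γ-clause `0 < w.γ ≤ θ.γ`:
if the merged β of record is jointly continuous on the record box `]0,θ.γ]^{k+1}` at every scale, then binder (B4) holds for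
the datum of record WITH N28's side condition, the witness being `γc := w.γ` — the binding world's own small-coupling window.
Hypothesis displayed, not asserted (its content is [I] §1 p. 264 ∕ NODE O's (D4) chain). [cite: Balaban1989LargeFieldII, Thm 1 p.355] -/
theorem b4_with_sideCondition_record₈ (θ : Stage8Params F N) (w : WorldP) (hw : 0 < w.γ ∧ w.γ ≤ θ.γ)
    (hC : letI := θ.instVβ₁; letI := θ.instVβ₂; letI := θ.instιβ
      BetaContH θ.γ (betaMerged F (mergedTermFamilyMat F N (chi7 F N θ) θ.εbg) θ.ρ8 θ.bV)) :
    0 < w.γ ∧ BetaContH w.γ (datumOfRecord₅ F N (θ.toStage5 F N)).βfun := by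
  refine ⟨hw.1, ?_⟩
  rw [βfun_stage8]
  exact betaContH_betaOfMerged_of_le hw.2 hw.2 hC

/-- **(B4) WITH ITS SIDE CONDITION AT A STAGE-8 RECORD, existential form.**  If at every admissible Stage-8 parameter whose datum
is `D` the merged β of record is jointly continuous on the record box, then a Stage-8 record `(D, w)` satisfies binder (B4)
with `0 < γc` — witness `γc := w.γ`. [cite: Balaban1989LargeFieldII, Thm 1 p.355] -/
theorem exists_b4_of_isRecordOfRecord₈C {D : FiniteEpsData F (SU N)} {w : WorldP} (h : IsRecordOfRecord₈C F N D w)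
    (hC : ∀ θ : Stage8Params F N, θ.Admissible → D = datumOfRecord₅ F N (θ.toStage5 F N) →
      letI := θ.instVβ₁; letI := θ.instVβ₂; letI := θ.instιβ
      BetaContH θ.γ (betaMerged F (mergedTermFamilyMat F N (chi7 F N θ) θ.εbg) θ.ρ8 θ.bV)) :
    ∃ γc : ℝ, 0 < γc ∧ BetaContH γc D.βfun := by
  obtain ⟨θ, hθ, hD, -, hw, -, -⟩ := h
  subst hD
  exact ⟨w.γ, hw.1, (b4_with_sideCondition_record₈ θ w hw (hC θ hθ rfl)).2⟩

/-- **THE CAP AT STAGE 8, as an `iff`.**  On a box LARGER than the record box, `θ.γ < γc`, binder (B4) holds for the Stage-8 datum's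
β-functions iff it holds for the merged β of record on the record box `]0,θ.γ]^{k+1}` AND the merged β equals its one-loop number
`beta0OfMerged … θ.v₀ k` at every history of the record box with a coordinate on the outer face `g_i = θ.γ`
(`N28GammaCap.betaContH_betaOfMerged_iff_of_lt` at `betaOfRecord₈ θ`).  So N28's `γc` at D₀ exceeds `θ.γ` only under that constraint
on Bałaban's β. [cite: Balaban1987RG1, (1.22) p.264 («defined on the interval [0, γ]»)] -/
theorem betaContH_record₈_iff_of_lt (θ : Stage8Params F N) {γc : ℝ} (hlt : θ.γ < γc) :
    letI := θ.instVβ₁; letI := θ.instVβ₂; letI := θ.instιβ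
    BetaContH γc (datumOfRecord₅ F N (θ.toStage5 F N)).βfun ↔
      BetaContH θ.γ (betaMerged F (mergedTermFamilyMat F N (chi7 F N θ) θ.εbg) θ.ρ8 θ.bV) ∧
        ∀ k (v : Fin (k + 1) → ℝ), v ∈ Box θ.γ k → ∀ i, v i = θ.γ →
          betaMerged F (mergedTermFamilyMat F N (chi7 F N θ) θ.εbg) θ.ρ8 θ.bV k v =
            beta0OfMerged (betaMerged F (mergedTermFamilyMat F N (chi7 F N θ) θ.εbg) θ.ρ8 θ.bV) θ.v₀ k := by
  rw [βfun_stage8]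
  exact betaContH_betaOfMerged_iff_of_lt hlt

/-- **THE CAP AT STAGE 8, pointwise.**  If binder (B4) holds for the Stage-8 datum on a box LARGER than the record box, `θ.γ < γc`,
then the merged β of record equals its one-loop number `beta0OfMerged … θ.v₀ k` at every history of the record box with a coordinate
on the outer face `g_i = θ.γ`. [cite: Balaban1987RG1, (1.22) p.264] -/
theorem merged₈_eq_beta0_on_outerFace_of_betaContH (θ : Stage8Params F N) {γc : ℝ} (hlt : θ.γ < γc)
    (hC : BetaContH γc (datumOfRecord₅ F N (θ.toStage5 F N)).βfun) {k : ℕ} {v : Fin (k + 1) → ℝ} (hv : v ∈ Box θ.γ k)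
    {i : Fin (k + 1)} (hi : v i = θ.γ) :
    letI := θ.instVβ₁; letI := θ.instVβ₂; letI := θ.instιβ
    betaMerged F (mergedTermFamilyMat F N (chi7 F N θ) θ.εbg) θ.ρ8 θ.bV k v =
      beta0OfMerged (betaMerged F (mergedTermFamilyMat F N (chi7 F N θ) θ.εbg) θ.ρ8 θ.bV) θ.v₀ k := by
  rw [βfun_stage8] at hC
  exact merged_eq_beta0_on_outerFace_of_betaContH hlt hC hv hi

/-! ## §2 The `β̄`-half at a Stage-8 record -/

/-- **EVERY SPLIT OF THE DATUM'S β IS THE SPLIT OF RECORD** (`N28AtBetaOfRecord.oneLoopSplit_unique`): a NODE-O road's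
`Sβ : OneLoopSplit D.βfun` at Stage 8 is `Node00.oneLoopSplit_stage8 θ`, never a choice. [cite: Balaban1987RG1, (2.12)–(2.14) p.268] -/
theorem oneLoopSplit_record₈_eq (θ : Stage8Params F N)
    (S : B12Beta.OneLoopSplit (datumOfRecord₅ F N (θ.toStage5 F N)).βfun) : S = oneLoopSplit_stage8 F N θ :=
  oneLoopSplit_unique S _

/-- **THE ONE-LOOP NUMBERS A NODE-O ROAD READS AT D₀ ARE `beta0OfMerged … θ.v₀` BY NAME**: for every split `Sβ` of the Stage-8
datum's β, `Sβ.β0 k` is the `limUnder (𝓝[>] 0)` object of `Node00.BetaOfRecord` at the merged β of record and the record's reference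
histories `θ.v₀`.  So N28's `β̄`-half in the END currencies ((AF-0) positivity of `Sβ.β0`, the drift slope, the tail) is a statement
about THAT named object. [cite: Balaban1987RG1, (2.12)–(2.14) p.268] -/
theorem oneLoopSplit_β0_record₈ (θ : Stage8Params F N)
    (S : B12Beta.OneLoopSplit (datumOfRecord₅ F N (θ.toStage5 F N)).βfun) (k : ℕ) :
    letI := θ.instVβ₁; letI := θ.instVβ₂; letI := θ.instιβ
    S.β0 k = beta0OfMerged (betaMerged F (mergedTermFamilyMat F N (chi7 F N θ) θ.εbg) θ.ρ8 θ.bV) θ.v₀ k := by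
  exact oneLoopSplit_β0_eq S k

/-- **THE REMAINDER WALL INPUT AT D₀.**  For every split of the Stage-8 datum's β and every box `]0,γ']^{k+1}` inside the record box
(`γ' ≤ θ.γ`), `RemainderConst Sβ γ' r` IS `|βm₈,k+1(p) − β⁰_{k+1}| ≤ r` on those boxes, with `βm₈` the merged β of record and `β⁰`
its one-loop numbers. [cite: Balaban1987RG1, Thm 2 p.259] -/
theorem remainderConst_record₈_iff (θ : Stage8Params F N)
    (S : B12Beta.OneLoopSplit (datumOfRecord₅ F N (θ.toStage5 F N)).βfun) {γ' r : ℝ} (hγ : γ' ≤ θ.γ) :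
    letI := θ.instVβ₁; letI := θ.instVβ₂; letI := θ.instιβ
    RemainderConst S γ' r ↔ ∀ k p, p ∈ B12Beta.HistBox γ' k →
      |betaMerged F (mergedTermFamilyMat F N (chi7 F N θ) θ.εbg) θ.ρ8 θ.bV k p -
        beta0OfMerged (betaMerged F (mergedTermFamilyMat F N (chi7 F N θ) θ.εbg) θ.ρ8 θ.bV) θ.v₀ k| ≤ r := by
  exact remainderConst_atRecord_iff S hγ

/-- **N28's `β̄` BECOMES (AF-0) OF THE ONE-LOOP NUMBERS OF RECORD.**  A uniform asymptotic-freedom bound `0 < b ≤ D.βfun` on a box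
`]0,γ']^{k+1}` inside the record box (`γ' ≤ θ.γ`) whose interior contains the record's reference histories `θ.v₀` (first `k` entries
in `]0,γ']`), together with the NAMED existence of the one-sided limits `Beta0LimitExists βm₈ θ.v₀`, gives `0 < b ≤ β⁰_k` for EVERY
`k`.  Hypotheses, not facts ([Balaban1989LargeFieldII] p. 355 «has not been published yet»). [cite: Balaban1989LargeFieldII, Thm 1 p.355] -/
theorem beta0_record₈_pos_of_betaLowerH (θ : Stage8Params F N)
    (hlim : letI := θ.instVβ₁; letI := θ.instVβ₂; letI := θ.instιβ
      Beta0LimitExists (betaMerged F (mergedTermFamilyMat F N (chi7 F N θ) θ.εbg) θ.ρ8 θ.bV) θ.v₀)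
    {b γ' : ℝ} (hγ' : 0 < γ') (hγ : γ' ≤ θ.γ) (hb : 0 < b)
    (hv₀ : ∀ k (i : Fin (k + 1)), i ≠ Fin.last k → 0 < θ.v₀ k i ∧ θ.v₀ k i ≤ γ')
    (hlo : BetaLowerH b γ' (datumOfRecord₅ F N (θ.toStage5 F N)).βfun) (k : ℕ) :
    letI := θ.instVβ₁; letI := θ.instVβ₂; letI := θ.instιβ
    0 < beta0OfMerged (betaMerged F (mergedTermFamilyMat F N (chi7 F N θ) θ.εbg) θ.ρ8 θ.bV) θ.v₀ k ∧
      b ≤ beta0OfMerged (betaMerged F (mergedTermFamilyMat F N (chi7 F N θ) θ.εbg) θ.ρ8 θ.bV) θ.v₀ k := by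
  rw [βfun_stage8] at hlo
  have hlo' := (betaLowerH_betaOfMerged_iff hγ).mp hlo
  exact ⟨beta0OfMerged_pos_of_betaLowerH hlim hγ' hb hv₀ hlo' k, le_beta0OfMerged_of_betaLowerH hlim hγ' hv₀ hlo' k⟩

/-- **THE LITERAL (B3) AT D₀ IS RIGID.**  If the remainder of a (hence THE) split of the Stage-8 datum's β vanishes along the diagonal
as `g → 0⁺` and the LITERAL binder (B3) `BetaPertH D.βfun β̄` holds for the datum, then every one-loop number of record equals `β̄`:
`beta0OfMerged βm₈ θ.v₀ k = β̄` for all `k` — N28's `β̄` would have to BE the (k-independent) one-loop number.  This is why the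
literal (B3) is superseded by `DagBinding.EndpointExistence` and N28 is VACATED with it. [cite: Balaban1989LargeFieldII, Thm 1 p.355] -/
theorem beta0_record₈_eq_betabar_of_literalB3 (θ : Stage8Params F N)
    (S : B12Beta.OneLoopSplit (datumOfRecord₅ F N (θ.toStage5 F N)).βfun) (hrem : RemainderVanishes S) {βbar : ℝ}
    (hP : BetaPertH (datumOfRecord₅ F N (θ.toStage5 F N)).βfun βbar) (k : ℕ) :
    letI := θ.instVβ₁; letI := θ.instVβ₂; letI := θ.instιβ
    beta0OfMerged (betaMerged F (mergedTermFamilyMat F N (chi7 F N θ) θ.εbg) θ.ρ8 θ.bV) θ.v₀ k = βbar := by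
  have hS : S = oneLoopSplit_betaOfMerged _ _ θ.γ := oneLoopSplit_unique S _
  subst hS
  rw [βfun_stage8] at hP
  exact beta0_eq_betabar_of_literalB3 hrem hP k

/-! ## §3 N28's literal pair at a Stage-8 record -/

/-- **N28's LITERAL PAIR AT D₀.**  At admissible Stage-8 parameters the packaged literal β-binder of the UV headline,
`T4Continuum.BetaPertHyp` (= (B3) with `0 < β̄` ∧ (B4) with `0 < γc`), holds for the datum's β-functions iff it holds for the merged β
of record (`N28AtBetaOfRecord.betaPertHyp_betaOfMerged_iff` at `0 < θ.γ`). [cite: Balaban1989LargeFieldII, Thm 1 p.355] -/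
theorem betaPertHyp_record₈_iff (θ : Stage8Params F N) (hθ : θ.Admissible) :
    letI := θ.instVβ₁; letI := θ.instVβ₂; letI := θ.instιβ
    BetaPertHyp (datumOfRecord₅ F N (θ.toStage5 F N)).βfun ↔
      BetaPertHyp (betaMerged F (mergedTermFamilyMat F N (chi7 F N θ) θ.εbg) θ.ρ8 θ.bV) := by
  rw [βfun_stage8]
  exact betaPertHyp_betaOfMerged_iff (gamma_pos_of_admissible₈ hθ)

/-- **N28 AT A STAGE-8 RECORD, packaged.**  At a Stage-8 record `(D, w)`: the window `w.γ` is positive; and IF the merged β of record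
of the witnessing `θ` satisfies the literal pair, so does `D.βfun` — with N28's two side conditions `0 < β̄`, `0 < γc` carried inside
`BetaPertHyp`.  All hypotheses displayed; nothing of Bałaban's β asserted. [cite: Balaban1989LargeFieldII, Thm 1 p.355] -/
theorem betaPertHyp_of_isRecordOfRecord₈C {D : FiniteEpsData F (SU N)} {w : WorldP} (h : IsRecordOfRecord₈C F N D w)
    (hP : ∀ θ : Stage8Params F N, θ.Admissible → D = datumOfRecord₅ F N (θ.toStage5 F N) →
      letI := θ.instVβ₁; letI := θ.instVβ₂; letI := θ.instιβ
      BetaPertHyp (betaMerged F (mergedTermFamilyMat F N (chi7 F N θ) θ.εbg) θ.ρ8 θ.bV)) :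
    0 < w.γ ∧ BetaPertHyp D.βfun := by
  obtain ⟨θ, hθ, hD, -, hw, -, -⟩ := h
  refine ⟨hw.1, ?_⟩
  rw [hD]
  exact (betaPertHyp_record₈_iff θ hθ).mpr (hP θ hθ hD)

end Summit.QuantumFields.YangMills.BalabanUVNodes.N28AtRecord8
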